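import Summits.BirchSwinnertonDyer.Rank1Residual.Additive.GordRankOneKatoCertificateClass
import Summits.BirchSwinnertonDyer.Rank1Residual.Additive.GordThreeCycRankOne
import Summits.BirchSwinnertonDyer.Rank1Residual.Additive.SemistableTwistTowerThree
import HarnessLib

/-!
# X4♯(G-ord) ∩ `I₀*` in analytic rank ONE at `p = 3` (O7-ord@3): Kato's divisibility on the
# `ω`-branch of `E♭` + the ONE-NUMBER branch-unit certificate ⟹ `μ = 0 ∧ λ ≤ 1`, and with
# Delbourgo 2002 at `3`: Schneider's `Reg₃(E,Dh) ≠ 0` PROVED and the exact `3`-adic valuation identity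
# (cell `b2b-bsdres`, team n1011, seat p12 (gen 2), OWNERS row T-O7K3; the `p = 3` twin of
# additive-p2 gen 19's `GordRankOneKatoCertificate[Class].lean`, input of record R5-4)

HONEST FRAMING (cell `b2b-bsdres`, run/shared/lean/b2b/bsd-rank1-residual/, verbatim in every
file): the goal of the cell is to DELETE the COMBINATION-SHAPED residual classes of the
Birch–Swinnerton-Dyer formula for ALL analytic-rank `≤ 1` elliptic curves over `ℚ` — "full BSD
formula for every rank `≤ 1` curve in class `C`" assembled STRICTLY from published theorems — so
that the rank-`≤ 1` remainder becomes exactly the CONSTRUCTION-SHAPED classes, which are TYPED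
(missing-input `Prop`s), NOT attempted. This is not "finishing BSD". Team n1011 (RESIDUAL-MAP §I
O7: analytic rank `1` at an additive prime; here O7-ord at `p = 3` on the (G)-ordinary defect-`2`
rows), seat `b2b-bsdres-n1011-p12` (gen 2), row T-O7K3 (lead R5-3): research route on the
CONSTRUCTION-SHAPED class O7; labels and marks UNCHANGED; nothing booked; NO Literature fact minted;
no definition. THEOREMS ONLY; named facts enter as HYPOTHESES (`hK` = the semistable big-image
half-eigenspace reading of Kato 2004 Thm. 17.4 (3) `Wuthrich2014.kato_halfEigenCharIdeal_dvd_cyclotomicPrime_of_surjective`;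
`hWu` = Wuthrich 2014 Thm. 16 `Wuthrich2014.thm16_halfEigenCharIdeal_dvd_cyclotomicPrime` on the X3
twin; `hDel3` = `Delbourgo2002.mainTheorem_three`, the `p = 3` form of Delbourgo, JNT 95 (2002)
Theorems (A)+(B), typed by n1011-p16; `hGZK`; `hmodD`); the per-pair CERTIFICATE is additive-p2's
typed input `BranchUnitCertificateAt W 3` BY NAME (nothing asserted; census EVIDENCE).

## What and why

additive-p2 gen 19 (`GordRankOneKatoCertificate.lean`, `…Class.lean`; INPUT OF RECORD, lead R5-4)
proved on X4♯(G-ord) ∩ `I₀*` ∩ {`ρ̄_{E,p}` onto}, **`p ≥ 5`**: Kato's divisibility on the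
`ω^{(p−1)/2}`-branch of `E♭` (full power series, `ι g = C(u·ϖ)·B`) + the ONE-NUMBER certificate
`BranchUnitCertificateAt W p` ("`ϖ·B` has constant term `0` and `‖[T¹]‖_p = 1`") ⟹ `μ(fE) = 0` and
`λ(fE) ≤ 1` for every generator `fE` of `char_Λ X(E/ℚ_∞)` — `p ≥ 5` entering ONLY through Serre's
lifting `surj(p) ⟹ ρ_{E,p^∞}` onto. At `p = 3` that lifting is n1011-p14's certificate-free tower on
the semistable-twist locus (`ClassX4Gord.towerSurj_of_surj`: Wuthrich 2014 Lemma 20 — a THEOREM in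
the tree since p250793/p251008 — on the good ordinary twist model, transported back along the
twist). So:

* §1 **every odd `p`, `p = 3` included**:
  `ClassX4Gord.isTorsion_and_mu_zero_lam_le_one_of_katoHalf_of_cert_oddPrime` and
  `ClassX4Gord.charLamLeAt_one_of_katoHalf_of_cert_oddPrime` — additive-p2's §3 with `hp5` replaced
  by the tower theorem (their `…_of_katoHalf_of_cert` is the `p ≥ 5` case; the X3 twin
  `ClassX3Gord.…_of_wuthrichHalf_of_cert` is already odd-`p` in their file).
* §2 **`p = 3`, analytic rank `1`** (`r_an = 1`; GZK ⟹ `rank E(ℚ) = 1`): with Delbourgo 2002 at `3`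
  (`hDel3`, n1011-p16's bridge `TypeGOrd.delbourgo2002_three`: Theorem (A) for every datum and a
  (B)-datum `Dh`; `¬CM` explicit) and n1011-p01's λ-certificate levers
  (`TypeGOrd.schneider_and_finite_three_of_charLamLe`, `padicVal_identity_of_charLamLe`):
  **Schneider's `Reg₃(E,Dh) ≠ 0` PROVED for every (B)-datum and `#Ш(E)[3^∞] < ∞`**
  (`ClassX4Gord.schneider_and_finite_three_rankOne_of_katoHalf_of_cert`, X3 twin
  `ClassX3Gord.…_of_wuthrichHalf_of_cert`), and **the EXACT identity
  `ord₃ #Ш(E)[3^∞] + ord₃ Reg₃(E,Dh) + ord₃ ∏c_ℓ + ord₃ ℓ = 1 + 2·ord₃ #E(ℚ)_tors`** with `λ(fE) = 1`,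
  `μ(fE) = 0`, Delbourgo's `ℓ ∣ 9` (`= 1` off the anomalous rows)
  (`ClassX4Gord.padicVal_identity_three_rankOne_of_katoHalf_of_cert`, X3 twin; and the `∃ Dh` forms).
* §3 **the LOWER half at `3` from the certificate + ONE regulator valuation** (n1011-p16's
  `TypeGOrd.missingLowerBoundAt_three_of_charLamLe_of_regulatorCertificate`):
  `ClassX4Gord.missingLowerBoundAt_three_rankOne_of_katoHalf_of_cert_of_regulatorCertificate`.

The closing form "`BSD(E,3) ⟺ ord₃ q + ord₃ Reg₃(E,Dh) = 1`" (twin of additive-p2's §5) is the sequel,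
written against their `…BSD.lean` once it lands (lead R5-3: wait, then import). What is NOT claimed:
the certificate (per pair, numerical: PARI `ellpadicL(E♭, 3, n, D = −3)`); anything on defect
`e ∈ {3,4,6,12}`, on the (M) rows, or on wild `3`; the `ℓ`-reading on anomalous rows; any booking.

References: K. Kato, Astérisque 295 (2004) Thm. 17.4 (3) [Kato2004Asterisque]; C. Wuthrich, Doc.
Math. 19 (2014) Thm. 16, Lemma 20 [Wuthrich2014]; D. Delbourgo, J. Number Theory 95 (2002) Thm. (A),
(B) [Delbourgo2002]; L. Washington, GTM 83 (1997) §7.1 [Washington1997]; B. Mazur, J. Tate,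
J. Teitelbaum, Invent. Math. 84 (1986) §I.13–I.14 [MazurTateTeitelbaum1986Invent].
-/

noncomputable section

open scoped Classical MatrixGroups ModularForm NumberField

namespace Summit.BirchSwinnertonDyer.Rank1Residual.Additive

open CongruenceSubgroup WeierstrassCurve NumberField Literature.NumberTheory.EllipticCurves
  Literature.NumberTheory.EllipticCurves.ModularForms
  Literature.NumberTheory.EllipticCurves.Rank1Residual
  Literature.NumberTheory.EllipticCurves.Rank1Residual.Typed
  Literature.NumberTheory.EllipticCurves.Delbourgo2002
  Literature.NumberTheory.GaloisRepresentations Summit.BirchSwinnertonDyer.Rank1Residual.AdditivePotMult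
  Summit.BirchSwinnertonDyer.Rank1Residual.X1.MuLambda
  Summit.BirchSwinnertonDyer.Rank1Residual.X1.RankOneParitySqueeze
  IsDedekindDomain

/-! ### §1 Every odd `p` (`p = 3` included): the certificate DISCHARGES `λ ≤ 1` and `μ = 0` -/

section OddPrime

variable {W : WeierstrassCurve ℚ} [W.IsElliptic] [W.IsGloballyMinimal] {p : ℕ} [hp : Fact p.Prime]

/-- **X4♯(G-ord) ∩ `I₀*` ∩ {`ρ̄_{E,p}` onto}, EVERY odd `p` (`p = 3` included): Kato's divisibility +
the one-number certificate ⟹ for every cyclotomic dual datum and every generator `fE` of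
`char_Λ X(E/ℚ_∞)`: `X` is torsion, `μ(fE) = 0` and `λ(fE) ≤ 1`.** additive-p2's
`ClassX4Gord.isTorsion_and_mu_zero_lam_le_one_of_katoHalf_of_cert` with Serre's `p ≥ 5` lifting
replaced by n1011-p14's certificate-free tower `ClassX4Gord.towerSurj_of_surj` (Wuthrich 2014
Lemma 20 on the good ordinary twist model — a tree theorem), transported to the twist model by
`GaloisImage.hasSurjectiveModNGaloisRep_pow_iff_of_model_twist`; then their full-series brick
`isTorsion_and_exists_iota_eq_branch_of_katoComponent` and `Λ`-algebra
`mu_eq_zero_and_lam_le_one_of_iota_eq`. NO Delbourgo, NO height, NO GZK here.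
[cite: Kato2004Asterisque, Thm. 17.4 (3) (p. 273)] [cite: Wuthrich2014, Lemma 20 (p. 399)]
[cite: Washington1997, §7.1] -/
theorem ClassX4Gord.isTorsion_and_mu_zero_lam_le_one_of_katoHalf_of_cert_oddPrime
    (hK : Wuthrich2014.kato_halfEigenCharIdeal_dvd_cyclotomicPrime_of_surjective)
    (hmodD : nonempty_modularParametrizationData)
    (hX : ClassX4Gord W p) (he : semistabilityIndex W p = 2) (hsurj : Surj W p)
    (hcert : BranchUnitCertificateAt W p)
    {κ : ZpExtension ℚ p} {γ : Field.absoluteGaloisGroup ℚ}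
    (hκ : κ.IsCyclotomic) (hγ : κ.IsTopGenerator γ) (hγ' : IsCyclotomicVariable p γ)
    (D : W.SelmerDualData κ γ) {fE : IwasawaAlgebra p} (hchar : D.charIdeal = Ideal.span {fE}) :
    D.IsTorsion ∧ mu fE = 0 ∧ lam fE ≤ 1 := by
  have hp2 : p ≠ 2 := hX.addv.1
  obtain ⟨V, iV, iVm, C, hV, hC⟩ := hX.exists_goodOrd_pStar_twist_model W p he
  haveI : NeZero (V.conductorNorm ℤ) := ⟨(V.conductorNorm_pos_holds).ne'⟩
  obtain ⟨Dm⟩ := hmodD V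
  obtain ⟨ϖ, hϖ⟩ := exists_periodRatio_parity (p := p) V Dm
  have hj := padicValRat_j_nonneg_of_typeGOrd W p hX.typeGOrd
  -- the `p`-adic tower of the twist model, from the certificate-free tower of `W`
  have hsurjV : ∀ n : ℕ, V.HasSurjectiveModNGaloisRep (p ^ n : ℕ) := fun n ↦
    (GaloisImage.hasSurjectiveModNGaloisRep_pow_iff_of_model_twist V p (pStar_ne_zero p) ⟨C, hC⟩
      n).mp (hX.towerSurj_of_surj he hsurj n)
  have hord : IsOrdinaryAt V p :=
    isOrdinaryAt_of_goodOrd_or_mult_of_model_twist W V (pStar_ne_zero p) ⟨C, hC⟩ hj (Or.inl hV)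
  obtain ⟨hXt, g, hg, u, hι⟩ := isTorsion_and_exists_iota_eq_branch_of_katoComponent W p
    (Kato2004.charIdeal_dvd_padicLFunctionBranch_component_of_surjective_of_half hK) hj hp2 V
    ⟨C, hC⟩ (Or.inl hV) hsurjV hκ hγ hγ' Dm.isNewformOf D ϖ hϖ
  obtain ⟨h0, h1⟩ := hcert V C hC hord Dm.f Dm.isNewformOf ϖ hϖ
  exact ⟨hXt, mu_eq_zero_and_lam_le_one_of_iota_eq D hchar hg hι h0 h1⟩

/-- Hence n1011-p01's typed λ-input `CharLamLeAt W p 1` HOLDS on X4♯(G-ord) ∩ `I₀*` ∩ {`ρ̄` onto}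
at EVERY odd `p`, given the certificate. [cite: Kato2004Asterisque, Thm. 17.4 (3) (p. 273)]
[cite: Wuthrich2014, Lemma 20 (p. 399)] -/
theorem ClassX4Gord.charLamLeAt_one_of_katoHalf_of_cert_oddPrime
    (hK : Wuthrich2014.kato_halfEigenCharIdeal_dvd_cyclotomicPrime_of_surjective)
    (hmodD : nonempty_modularParametrizationData)
    (hX : ClassX4Gord W p) (he : semistabilityIndex W p = 2) (hsurj : Surj W p)
    (hcert : BranchUnitCertificateAt W p) : CharLamLeAt W p 1 :=
  fun _ _ hκ hγ hγ' D _ hchar ↦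
    (hX.isTorsion_and_mu_zero_lam_le_one_of_katoHalf_of_cert_oddPrime hK hmodD he hsurj hcert hκ hγ hγ'
      D hchar).2.2

end OddPrime

/-! ### §2 `p = 3`, analytic rank ONE: Schneider PROVED and the exact `3`-adic identity -/

section Three

variable {W : WeierstrassCurve ℚ} [W.IsElliptic] [W.IsGloballyMinimal] [hp : Fact (Nat.Prime 3)]

/-- **O7-ord@3 ∩ X4♯(G-ord) ∩ `I₀*` ∩ surj(3), `r_an = 1`, non-CM: Schneider's `Reg₃(E,Dh) ≠ 0` is
PROVED for every Delbourgo (B)-datum, and `#Ш(E)[3^∞] < ∞`** — §1 at `p = 3` gives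
`CharLamLeAt W 3 1 = CharLamLeAt W 3 (rank E(ℚ))` (GZK), and n1011-p16's λ-certificate lever at `3`
(`TypeGOrd.schneider_and_finite_three_of_charLamLe`, over Delbourgo 2002 at `3` `hDel3` via
`TypeGOrd.delbourgo2002_three`) concludes. NOT a class theorem (certificate `hcert` per pair).
[cite: Delbourgo2002, Theorem (A), (B) (p. 40)] [cite: Kato2004Asterisque, Thm. 17.4 (3) (p. 273)]
[cite: Washington1997, §7.1] -/
theorem ClassX4Gord.schneider_and_finite_three_rankOne_of_katoHalf_of_cert
    (hK : Wuthrich2014.kato_halfEigenCharIdeal_dvd_cyclotomicPrime_of_surjective)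
    (hmodD : nonempty_modularParametrizationData) (hDel3 : Delbourgo2002.mainTheorem_three)
    (hGZK : rank_eq_analyticRank_of_analyticRank_le_one)
    (hX : ClassX4Gord W 3) (he : semistabilityIndex W 3 = 2) (hsurj : Surj W 3)
    (hcert : BranchUnitCertificateAt W 3) (hcm : ¬ W.HasCM) (hr : W.analyticRank = 1) :
    (∀ Dh : PAdicHeightData W 3, LeadingTermClauses W 3 Dh → SchneiderConjecture Dh) ∧
      Finite (AddCommGroup.primaryComponent W.sha 3) := by
  have hlam : CharLamLeAt W 3 W.mordellWeilRank := by
    rw [(hGZK W hr.le).1.trans hr]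
    exact hX.charLamLeAt_one_of_katoHalf_of_cert_oddPrime hK hmodD he hsurj hcert
  exact TypeGOrd.schneider_and_finite_three_of_charLamLe hDel3 hX.typeGOrd hX.addv.2 hcm hlam

/-- **X3♯(G-ord) ∩ `I₀*` at `3`, `r_an = 1`, non-CM: Schneider PROVED for every (B)-datum and
`#Ш(E)[3^∞] < ∞`** — from Wuthrich 2014 Thm. 16 (`hWu`; additive-p2's odd-`p`
`ClassX3Gord.charLamLeAt_one_of_wuthrichHalf_of_cert`) + the certificate + Delbourgo 2002 at `3`.
[cite: Delbourgo2002, Theorem (A), (B) (p. 40)] [cite: Wuthrich2014, Thm. 16 (p. 397)] -/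
theorem ClassX3Gord.schneider_and_finite_three_rankOne_of_wuthrichHalf_of_cert
    (hWu : Wuthrich2014.thm16_halfEigenCharIdeal_dvd_cyclotomicPrime)
    (hmodD : nonempty_modularParametrizationData) (hDel3 : Delbourgo2002.mainTheorem_three)
    (hGZK : rank_eq_analyticRank_of_analyticRank_le_one)
    (hX : ClassX3Gord W 3) (he : semistabilityIndex W 3 = 2)
    (hcert : BranchUnitCertificateAt W 3) (hcm : ¬ W.HasCM) (hr : W.analyticRank = 1) :
    (∀ Dh : PAdicHeightData W 3, LeadingTermClauses W 3 Dh → SchneiderConjecture Dh) ∧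
      Finite (AddCommGroup.primaryComponent W.sha 3) := by
  have hlam : CharLamLeAt W 3 W.mordellWeilRank := by
    rw [(hGZK W hr.le).1.trans hr]
    exact hX.charLamLeAt_one_of_wuthrichHalf_of_cert hWu hmodD (by decide) he hcert
  exact TypeGOrd.schneider_and_finite_three_of_charLamLe hDel3 hX.typeGOrd hX.addv hcm hlam

/-- **O7-ord@3 ∩ X4♯(G-ord) ∩ `I₀*` ∩ surj(3), `r_an = 1`: the EXACT `3`-adic identity for every
Delbourgo (B)-datum `Dh` and every cyclotomic dual datum with generator `fE`** — `Reg₃(E,Dh) ≠ 0`,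
`#Ш(E)[3^∞] < ∞`, `λ(fE) = 1`, `μ(fE) = 0`, and
`ord₃ #Ш(E)[3^∞] + ord₃ Reg₃(E,Dh) + ord₃ ∏c_ℓ + ord₃ ℓ = 1 + 2·ord₃ #E(ℚ)_tors` with Delbourgo's
`ℓ ∣ 9`, `ℓ = 1` off the anomalous rows (n1011-p01's `padicVal_identity_of_charLamLe` with §1's
`μ = 0`, `λ ≤ 1` and GZK's `rank = 1`). `Ш` and `Reg₃` are now tied by ONE equation; no `#Ш_an`.
[cite: Delbourgo2002, Theorem (B) (p. 40)] [cite: Kato2004Asterisque, Thm. 17.4 (3) (p. 273)]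
[cite: Washington1997, §7.1] -/
theorem ClassX4Gord.padicVal_identity_three_rankOne_of_katoHalf_of_cert
    (hK : Wuthrich2014.kato_halfEigenCharIdeal_dvd_cyclotomicPrime_of_surjective)
    (hmodD : nonempty_modularParametrizationData)
    (hGZK : rank_eq_analyticRank_of_analyticRank_le_one)
    (hX : ClassX4Gord W 3) (he : semistabilityIndex W 3 = 2) (hsurj : Surj W 3)
    (hcert : BranchUnitCertificateAt W 3) (hr : W.analyticRank = 1)
    {Dh : PAdicHeightData W 3} (hB : LeadingTermClauses W 3 Dh)
    {κ : ZpExtension ℚ 3} {γ : Field.absoluteGaloisGroup ℚ}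
    (hκ : κ.IsCyclotomic) (hγ : κ.IsTopGenerator γ) (hγ' : IsCyclotomicVariable 3 γ)
    (D : W.SelmerDualData κ γ) {fE : IwasawaAlgebra 3} (hchar : D.charIdeal = Ideal.span {fE}) :
    SchneiderConjecture Dh ∧ Finite (AddCommGroup.primaryComponent W.sha 3) ∧ lam fE = 1 ∧
      mu fE = 0 ∧
      ∃ ℓ : ℕ, ℓ ∣ 3 ^ 2 ∧ (ReductionNonAnomalous W 3 → ℓ = 1) ∧
        (padicValNat 3 (Nat.card (AddCommGroup.primaryComponent W.sha 3)) : ℤ) +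
            (padicRegulator Dh).valuation + padicValNat 3 W.tamagawaProduct + padicValNat 3 ℓ =
          1 + 2 * padicValNat 3 W.torsionOrder := by
  haveI : Module.Finite (IwasawaAlgebra 3) D.X := D.module_finite_holds hγ
  have hrk : W.mordellWeilRank = 1 := (hGZK W hr.le).1.trans hr
  obtain ⟨hXt, hmu, hlam1⟩ := hX.isTorsion_and_mu_zero_lam_le_one_of_katoHalf_of_cert_oddPrime hK
    hmodD he hsurj hcert hκ hγ hγ' D hchar
  obtain ⟨hS, hfin, hlamr, ℓ, hℓ, hℓ1, hid⟩ := padicVal_identity_of_charLamLe W 3 hB (by decide) hκ hγ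
    hγ' D hXt hchar (by rw [hrk]; exact hlam1)
  refine ⟨hS, hfin, by rw [hlamr, hrk], hmu, ℓ, hℓ, hℓ1, ?_⟩
  rw [hmu, hrk, Nat.cast_zero, zero_add, Nat.cast_one] at hid
  exact hid

/-- **The same with the (B)-datum SUPPLIED by Delbourgo 2002 at `3`** (`hDel3`, non-CM): there is a
height datum `Dh` satisfying the (B)-clauses, and for it (indeed for every such) the identity holds.
[cite: Delbourgo2002, Theorem (A), (B) (p. 40)] [cite: Kato2004Asterisque, Thm. 17.4 (3) (p. 273)] -/
theorem ClassX4Gord.exists_padicVal_identity_three_rankOne_of_katoHalf_of_cert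
    (hK : Wuthrich2014.kato_halfEigenCharIdeal_dvd_cyclotomicPrime_of_surjective)
    (hmodD : nonempty_modularParametrizationData) (hDel3 : Delbourgo2002.mainTheorem_three)
    (hGZK : rank_eq_analyticRank_of_analyticRank_le_one)
    (hX : ClassX4Gord W 3) (he : semistabilityIndex W 3 = 2) (hsurj : Surj W 3)
    (hcert : BranchUnitCertificateAt W 3) (hcm : ¬ W.HasCM) (hr : W.analyticRank = 1)
    {κ : ZpExtension ℚ 3} {γ : Field.absoluteGaloisGroup ℚ}
    (hκ : κ.IsCyclotomic) (hγ : κ.IsTopGenerator γ) (hγ' : IsCyclotomicVariable 3 γ)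
    (D : W.SelmerDualData κ γ) {fE : IwasawaAlgebra 3} (hchar : D.charIdeal = Ideal.span {fE}) :
    ∃ Dh : PAdicHeightData W 3, LeadingTermClauses W 3 Dh ∧ SchneiderConjecture Dh ∧
      Finite (AddCommGroup.primaryComponent W.sha 3) ∧ lam fE = 1 ∧ mu fE = 0 ∧
      ∃ ℓ : ℕ, ℓ ∣ 3 ^ 2 ∧ (ReductionNonAnomalous W 3 → ℓ = 1) ∧
        (padicValNat 3 (Nat.card (AddCommGroup.primaryComponent W.sha 3)) : ℤ) +
            (padicRegulator Dh).valuation + padicValNat 3 W.tamagawaProduct + padicValNat 3 ℓ =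
          1 + 2 * padicValNat 3 W.torsionOrder := by
  obtain ⟨-, Dh, hB⟩ := TypeGOrd.delbourgo2002_three hDel3 hX.typeGOrd hX.addv.2 hcm
  exact ⟨Dh, hB, hX.padicVal_identity_three_rankOne_of_katoHalf_of_cert hK hmodD hGZK he hsurj hcert hr
    hB hκ hγ hγ' D hchar⟩

/-- **X3♯(G-ord) ∩ `I₀*` at `3`, `r_an = 1`: the EXACT `3`-adic identity for every (B)-datum and every
cyclotomic dual datum**, from Wuthrich 2014 Thm. 16 (`hWu`) + the certificate (additive-p2's odd-`p`
`ClassX3Gord.isTorsion_and_mu_zero_lam_le_one_of_wuthrichHalf_of_cert`) + n1011-p01's identity.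
[cite: Delbourgo2002, Theorem (B) (p. 40)] [cite: Wuthrich2014, Thm. 16 (p. 397)] [cite: Washington1997, §7.1] -/
theorem ClassX3Gord.padicVal_identity_three_rankOne_of_wuthrichHalf_of_cert
    (hWu : Wuthrich2014.thm16_halfEigenCharIdeal_dvd_cyclotomicPrime)
    (hmodD : nonempty_modularParametrizationData)
    (hGZK : rank_eq_analyticRank_of_analyticRank_le_one)
    (hX : ClassX3Gord W 3) (he : semistabilityIndex W 3 = 2)
    (hcert : BranchUnitCertificateAt W 3) (hr : W.analyticRank = 1)
    {Dh : PAdicHeightData W 3} (hB : LeadingTermClauses W 3 Dh)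
    {κ : ZpExtension ℚ 3} {γ : Field.absoluteGaloisGroup ℚ}
    (hκ : κ.IsCyclotomic) (hγ : κ.IsTopGenerator γ) (hγ' : IsCyclotomicVariable 3 γ)
    (D : W.SelmerDualData κ γ) {fE : IwasawaAlgebra 3} (hchar : D.charIdeal = Ideal.span {fE}) :
    SchneiderConjecture Dh ∧ Finite (AddCommGroup.primaryComponent W.sha 3) ∧ lam fE = 1 ∧
      mu fE = 0 ∧
      ∃ ℓ : ℕ, ℓ ∣ 3 ^ 2 ∧ (ReductionNonAnomalous W 3 → ℓ = 1) ∧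
        (padicValNat 3 (Nat.card (AddCommGroup.primaryComponent W.sha 3)) : ℤ) +
            (padicRegulator Dh).valuation + padicValNat 3 W.tamagawaProduct + padicValNat 3 ℓ =
          1 + 2 * padicValNat 3 W.torsionOrder := by
  haveI : Module.Finite (IwasawaAlgebra 3) D.X := D.module_finite_holds hγ
  have hrk : W.mordellWeilRank = 1 := (hGZK W hr.le).1.trans hr
  obtain ⟨hXt, hmu, hlam1⟩ := hX.isTorsion_and_mu_zero_lam_le_one_of_wuthrichHalf_of_cert hWu hmodD
    (by decide) he hcert hκ hγ hγ' D hchar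
  obtain ⟨hS, hfin, hlamr, ℓ, hℓ, hℓ1, hid⟩ := padicVal_identity_of_charLamLe W 3 hB (by decide) hκ hγ
    hγ' D hXt hchar (by rw [hrk]; exact hlam1)
  refine ⟨hS, hfin, by rw [hlamr, hrk], hmu, ℓ, hℓ, hℓ1, ?_⟩
  rw [hmu, hrk, Nat.cast_zero, zero_add, Nat.cast_one] at hid
  exact hid

/-! ### §3 The LOWER half at `3` in rank one: the certificate + ONE regulator valuation -/

/-- **O7-ord@3 ∩ X4♯(G-ord) ∩ `I₀*` ∩ surj(3), `r_an = 1`, non-CM, non-anomalous: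
`Typed.MissingLowerBoundAt W 3` from the branch-unit certificate and ONE regulator-valuation
certificate** (`ord₃ Reg₃(Dh) + ord₃ #Ш_an + ord₃ ∏c ≤ 1 + 2·ord₃ #tors` for the (B)-data; n1011-p16's
`TypeGOrd.missingLowerBoundAt_three_of_charLamLe_of_regulatorCertificate`).
[cite: Delbourgo2002, Theorem (A), (B) (p. 40)] [cite: Miller2011LMS, Def. 1.1]
[cite: Kato2004Asterisque, Thm. 17.4 (3) (p. 273)] -/
theorem ClassX4Gord.missingLowerBoundAt_three_rankOne_of_katoHalf_of_cert_of_regulatorCertificate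
    (hK : Wuthrich2014.kato_halfEigenCharIdeal_dvd_cyclotomicPrime_of_surjective)
    (hmodD : nonempty_modularParametrizationData) (hDel3 : Delbourgo2002.mainTheorem_three)
    (hGZK : rank_eq_analyticRank_of_analyticRank_le_one)
    (hX : ClassX4Gord W 3) (he : semistabilityIndex W 3 = 2) (hsurj : Surj W 3)
    (hcert : BranchUnitCertificateAt W 3) (hcm : ¬ W.HasCM) (hr : W.analyticRank = 1)
    (hna : ReductionNonAnomalous W 3) {s : ℚ} (hs : shaAn W = (s : ℂ))
    (hreg : ∀ Dh : PAdicHeightData W 3, LeadingTermClauses W 3 Dh →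
      (padicRegulator Dh).valuation + padicValRat 3 s + padicValNat 3 W.tamagawaProduct ≤
        (W.mordellWeilRank : ℤ) + 2 * padicValNat 3 W.torsionOrder) :
    MissingLowerBoundAt W 3 := by
  have hlam : CharLamLeAt W 3 W.mordellWeilRank := by
    rw [(hGZK W hr.le).1.trans hr]
    exact hX.charLamLeAt_one_of_katoHalf_of_cert_oddPrime hK hmodD he hsurj hcert
  exact TypeGOrd.missingLowerBoundAt_three_of_charLamLe_of_regulatorCertificate hDel3 hGZK hX.typeGOrd
    hX.addv.2 hcm hr.le hna hlam hs hreg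

end Three

end Summit.BirchSwinnertonDyer.Rank1Residual.Additive

end
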